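import Summits.QuantumAdvantage.QuantumAdvantage.Theorems.CubicForrelationNearExactIsExactCubicEvenOnFourFlat
import Summits.QuantumAdvantage.QuantumAdvantage.Theorems.CubicForrelationNearExactIsExactTenCharacter
import Summits.QuantumAdvantage.QuantumAdvantage.Theorems.CubicForrelationNearExactIsExactDerivDegree
import Summits.QuantumAdvantage.QuantumAdvantage.Theorems.CubicForrelationNearExactIsExactInvariantWeight

/-!
# Crux `CubicForrelation.NearExactIsExact` (stmt-QuantumAdvantage-14043) — SYMPLECTIC EXTRACTION for quadratic forms

Certificate seat `b2b-cforr-cert` (generation 2), rung `θ₈ = 13/16`.  HONEST FRAMING: elementary finite-field lemmas feeding a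
theorem about cubic Boolean functions on 8 bits — NOT summit progress.

For a Boolean function `q` of algebraic degree `≤ 2` on `𝔽₂ⁿ` the second derivative
`B(a,b) = q(x) ⊕ q(x⊕a) ⊕ q(x⊕b) ⊕ q(x⊕a⊕b)` does not depend on `x` (`es_second_deriv`, from the landed `stub_derivDegree` twice and
`tc_const_of_deg_zero`); it is alternating and biadditive (`es_B_self`, `es_B_symm`, `es_B_add_left`).  If NO Walsh value of `q`
vanishes (in particular if `q` is bent) then `B` is non-degenerate (`es_nondeg`: a radical vector `a` gives
`W_q(y) = ±(−1)^{a·y} W_q(y)`, which kills `W_q` on half of the `y`), and then (for `n ≥ 3`) one extracts two `B`-orthogonal hyperbolic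
pairs `a₀,a₁,a₂,a₃` — `B(a₀,a₁) = B(a₂,a₃) = 1`, all four cross values `0` — by symplectic Gram–Schmidt (`es_extract`).  On the
parametrised 4-flat `x₀ ⊕ ⟨a₀,a₁,a₂,a₃⟩` the function is then `q(x₀) ⊕ Σ εᵢDᵢ ⊕ ε₀ε₁ ⊕ ε₂ε₃` (`es_taylor_point`), whose sign sum over the
`16` parameters is `±4` (`es_flat_signsum`: `#ones ∈ {6, 10}` by `decide`).  Consumed by the type-O half of the `13/16` isolation theorem
on 8 bits: there a bent quadratic digit would have to have all parametrised 4-flat sign sums `≡ 0 (mod 8)`.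

References: L. E. Dickson, *Linear Groups* (1901), Ch. VIII (normal form of quadratic forms over `𝔽₂`); F. J. MacWilliams,
N. J. A. Sloane, *The Theory of Error-Correcting Codes* (1977), Ch. 15 §2 (symplectic forms and second-order Reed–Muller codes);
C. Carlet, *Boolean Functions for Cryptography and Coding Theory*, CUP 2021, §5.2.  Everything below is proved from Mathlib and the
tree; axioms are the standard three.
-/

set_option linter.dupNamespace false -- D-0017: single-problem summit ⇒ `QuantumAdvantage.QuantumAdvantage` by design

noncomputable section

namespace Summit.QuantumAdvantage.QuantumAdvantage.Theorems.CubicForrelation.NearExactIsExact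

open Finset
open Literature.Computability.QuantumComplexity
open Literature.Computability.QuantumComplexity.BuzetChailloux (bxor zeroVec bxor_bxor_cancel_left twist_zeroVec_right
  twist_bxor_right bxor_zeroVec zeroVec_bxor bxor_self bxor_comm bxor_eq_zeroVec_iff)
open Literature.Computability.QuantumComplexity.DerivativeWalsh (W twist_bxor_left)
open Summit.QuantumAdvantage.QuantumAdvantage.Theorems.CubicForrelation.ExactPairsMaioranaMcFarland (dv_bxor_right_comm)

variable {n : ℕ}

/-! ### The second derivative of a quadratic is a constant alternating biadditive form -/

/-- **Second derivatives of a quadratic are constant**: for `q` of degree `≤ 2`,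
`q(x⊕a⊕b) = q(x) ⊕ q(x⊕a) ⊕ q(x⊕b) ⊕ B(a,b)` with `B(a,b) = q(0) ⊕ q(a) ⊕ q(b) ⊕ q(a⊕b)`. [cite: Carlet2020, §5.2] -/
theorem es_second_deriv (q : (Fin n → Bool) → Bool) (hq : IsDegLeFun 2 q) (x a b : Fin n → Bool) :
    q (bxor (bxor x a) b) = (q x ^^ q (bxor x a) ^^ q (bxor x b) ^^ (q zeroVec ^^ q a ^^ q b ^^ q (bxor a b))) := by
  have h1 : IsDegLeFun 1 (fun y => q y ^^ q (bxor y a)) := stub_derivDegree n 1 q a hq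
  have h0 : IsDegLeFun 0 (fun y => (q y ^^ q (bxor y a)) ^^ (q (bxor y b) ^^ q (bxor (bxor y b) a))) :=
    stub_derivDegree n 0 (fun y => q y ^^ q (bxor y a)) b h1
  have hc := tc_const_of_deg_zero h0 x zeroVec
  simp only [zeroVec_bxor] at hc
  rw [dv_bxor_right_comm x b a, bxor_comm b a] at hc
  revert hc
  cases q x <;> cases q (bxor x a) <;> cases q (bxor x b) <;> cases q (bxor (bxor x a) b) <;> cases q zeroVec <;>
    cases q a <;> cases q b <;> cases q (bxor a b) <;> decide

/-- `B(a,a) = 0`. [folklore] -/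
theorem es_B_self (q : (Fin n → Bool) → Bool) (a : Fin n → Bool) :
    (q zeroVec ^^ q a ^^ q a ^^ q (bxor a a)) = false := by
  rw [bxor_self]; cases q zeroVec <;> cases q a <;> rfl

/-- `B(a,b) = B(b,a)`. [folklore] -/
theorem es_B_symm (q : (Fin n → Bool) → Bool) (a b : Fin n → Bool) :
    (q zeroVec ^^ q a ^^ q b ^^ q (bxor a b)) = (q zeroVec ^^ q b ^^ q a ^^ q (bxor b a)) := by
  rw [bxor_comm]; cases q zeroVec <;> cases q a <;> cases q b <;> rfl

/-- **Biadditivity**: `B(a ⊕ a', b) = B(a,b) ⊕ B(a',b)` for `q` of degree `≤ 2`. [cite: Carlet2020, §5.2] -/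
theorem es_B_add_left (q : (Fin n → Bool) → Bool) (hq : IsDegLeFun 2 q) (a a' b : Fin n → Bool) :
    (q zeroVec ^^ q (bxor a a') ^^ q b ^^ q (bxor (bxor a a') b)) =
      ((q zeroVec ^^ q a ^^ q b ^^ q (bxor a b)) ^^ (q zeroVec ^^ q a' ^^ q b ^^ q (bxor a' b))) := by
  have h1 := es_second_deriv q hq a a' b
  have h2 : q (bxor a' b) = (q zeroVec ^^ q a' ^^ q b ^^ (q zeroVec ^^ q a' ^^ q b ^^ q (bxor a' b))) := by
    cases q zeroVec <;> cases q a' <;> cases q b <;> cases q (bxor a' b) <;> rfl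
  rw [h1]
  cases q zeroVec <;> cases q a <;> cases q a' <;> cases q b <;> cases q (bxor a a') <;> cases q (bxor a b) <;>
    cases q (bxor a' b) <;> decide

/-! ### Non-degeneracy from non-vanishing Walsh values -/

/-- A non-zero vector has a character value `−1` somewhere: `(−1)^{a·e_i} = −1` at a coordinate `i` with `a_i = 1`. [folklore] -/
theorem es_exists_twist_neg {a : Fin n → Bool} (ha : a ≠ zeroVec) : ∃ y, twist a y = -1 := by
  obtain ⟨i, hi⟩ : ∃ i, a i = true := by
    by_contra h
    push Not at h
    exact ha (funext fun i => by simpa [zeroVec] using h i)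
  refine ⟨Pi.single i true, ?_⟩
  rw [twist_comm, fc_twist_single, hi]
  rfl

/-- **Non-degeneracy.** If NO Walsh value of `q` vanishes, then every non-zero `a` has a partner `b` with
`B(a,b) = 1`: otherwise the derivative `D_a q` is a constant `c`, and re-indexing `x ↦ x ⊕ a` in `W_q(y)` gives
`W_q(y) = (−1)^c (−1)^{a·y} W_q(y)`, so `W_q(y) = 0` for a suitable `y`. [cite: Carlet2020, §5.2] -/
theorem es_nondeg (q : (Fin n → Bool) → Bool) (hW : ∀ y, W (fun x => signOf (q x)) y ≠ 0)
    {a : Fin n → Bool} (ha : a ≠ zeroVec) : ∃ b, (q zeroVec ^^ q a ^^ q b ^^ q (bxor a b)) = true := by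
  by_contra hno
  push Not at hno
  simp only [Bool.not_eq_true] at hno
  -- the derivative along `a` is the constant `c = q 0 ⊕ q a`
  have hD : ∀ x, q (bxor x a) = (q x ^^ (q zeroVec ^^ q a)) := by
    intro x
    have h := hno x
    rw [bxor_comm] at h
    revert h
    cases q zeroVec <;> cases q a <;> cases q x <;> cases q (bxor x a) <;> decide
  -- choose `y` with `(−1)^c (−1)^{a·y} = −1`
  obtain ⟨y, hy⟩ : ∃ y, signOf (q zeroVec ^^ q a) * twist a y = -1 := by
    cases hc : (q zeroVec ^^ q a)
    · obtain ⟨y, hy⟩ := es_exists_twist_neg ha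
      exact ⟨y, by rw [hy]; norm_num [signOf]⟩
    · exact ⟨zeroVec, by rw [twist_zeroVec_right]; norm_num [signOf]⟩
  -- re-index the Walsh sum by `x ↦ x ⊕ a`
  have hre : W (fun x => signOf (q x)) y = ∑ x, signOf (q (bxor x a)) * twist (bxor x a) y := by
    show (∑ x, signOf (q x) * twist x y) = _
    exact (Fintype.sum_equiv (Equiv.mk (fun x => bxor x a) (fun x => bxor x a)
      (fun x => by simp [iw_bxor_assoc]) (fun x => by simp [iw_bxor_assoc]))
      (fun x => signOf (q (bxor x a)) * twist (bxor x a) y) (fun x => signOf (q x) * twist x y) fun x => rfl).symm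
  have hre' : W (fun x => signOf (q x)) y = signOf (q zeroVec ^^ q a) * twist a y * W (fun x => signOf (q x)) y :=
    calc W (fun x => signOf (q x)) y = ∑ x, signOf (q (bxor x a)) * twist (bxor x a) y := hre
      _ = ∑ x, signOf (q zeroVec ^^ q a) * twist a y * (signOf (q x) * twist x y) :=
          sum_congr rfl fun x _ => by rw [hD x, signOf_xor, twist_bxor_left]; ring
      _ = signOf (q zeroVec ^^ q a) * twist a y * W (fun x => signOf (q x)) y := by rw [← mul_sum]; rfl
  rw [hy] at hre'
  exact hW y (by linarith)

/-! ### Extraction of two orthogonal hyperbolic pairs -/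

/-- **Symplectic extraction.** For `q` of degree `≤ 2` on `n ≥ 3` bits with no vanishing Walsh value there are `a₀,a₁,a₂,a₃` with
`B(a₀,a₁) = B(a₂,a₃) = 1` and `B(aᵢ,aⱼ) = 0` for the four cross pairs (symplectic Gram–Schmidt; `a₂` is a difference of two points of a
large fibre of `x ↦ (B(x,a₀), B(x,a₁))`). [cite: MacWilliamsSloane1977, Ch. 15 §2] -/
theorem es_extract (hn : 3 ≤ n) (q : (Fin n → Bool) → Bool) (hq : IsDegLeFun 2 q)
    (hW : ∀ y, W (fun x => signOf (q x)) y ≠ 0) :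
    ∃ a₀ a₁ a₂ a₃ : Fin n → Bool,
      (q zeroVec ^^ q a₀ ^^ q a₁ ^^ q (bxor a₀ a₁)) = true ∧ (q zeroVec ^^ q a₂ ^^ q a₃ ^^ q (bxor a₂ a₃)) = true ∧
      (q zeroVec ^^ q a₀ ^^ q a₂ ^^ q (bxor a₀ a₂)) = false ∧ (q zeroVec ^^ q a₀ ^^ q a₃ ^^ q (bxor a₀ a₃)) = false ∧
      (q zeroVec ^^ q a₁ ^^ q a₂ ^^ q (bxor a₁ a₂)) = false ∧ (q zeroVec ^^ q a₁ ^^ q a₃ ^^ q (bxor a₁ a₃)) = false := by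
  classical
  -- abbreviation-free: `B u v` is spelled out; symmetry and additivity lemmas
  have hsymm := es_B_symm q
  have hadd := es_B_add_left q hq
  -- first pair
  have ha₀ : (Pi.single ⟨0, by omega⟩ true : Fin n → Bool) ≠ zeroVec := by
    intro h; have := congrFun h ⟨0, by omega⟩; simp [zeroVec] at this
  set a₀ : Fin n → Bool := Pi.single ⟨0, by omega⟩ true with ha₀def
  obtain ⟨a₁, h01⟩ := es_nondeg q hW ha₀
  -- a non-zero vector orthogonal to both
  have hfib : ∃ c : Bool × Bool, 1 < #(univ.filter fun x : Fin n → Bool =>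
      ((q zeroVec ^^ q x ^^ q a₀ ^^ q (bxor x a₀)), (q zeroVec ^^ q x ^^ q a₁ ^^ q (bxor x a₁))) = c) := by
    refine Fintype.exists_lt_card_fiber_of_mul_lt_card _ ?_
    rw [Fintype.card_prod, Fintype.card_bool, Fintype.card_fun, Fintype.card_bool, Fintype.card_fin]
    calc 2 * 2 * 1 = 2 ^ 2 := by norm_num
      _ < 2 ^ n := Nat.pow_lt_pow_right (by norm_num) (by omega)
  obtain ⟨c, hc⟩ := hfib
  obtain ⟨x, hx, x', hx', hxx'⟩ := one_lt_card.1 hc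
  have hxc := (mem_filter.1 hx).2
  have hx'c := (mem_filter.1 hx').2
  set a₂ := bxor x x' with ha₂def
  have ha₂ : a₂ ≠ zeroVec := fun h => hxx' ((bxor_eq_zeroVec_iff x x').1 h)
  have h20 : (q zeroVec ^^ q a₂ ^^ q a₀ ^^ q (bxor a₂ a₀)) = false := by
    rw [ha₂def, hadd, (Prod.mk.inj (hxc.trans hx'c.symm)).1, Bool.xor_self]
  have h21 : (q zeroVec ^^ q a₂ ^^ q a₁ ^^ q (bxor a₂ a₁)) = false := by
    rw [ha₂def, hadd, (Prod.mk.inj (hxc.trans hx'c.symm)).2, Bool.xor_self]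
  obtain ⟨b, h2b⟩ := es_nondeg q hW ha₂
  have h00 := es_B_self q a₀
  have h11 := es_B_self q a₁
  have h10 : (q zeroVec ^^ q a₁ ^^ q a₀ ^^ q (bxor a₁ a₀)) = true := by rw [hsymm]; exact h01
  have h02 : (q zeroVec ^^ q a₀ ^^ q a₂ ^^ q (bxor a₀ a₂)) = false := by rw [hsymm]; exact h20
  have h12 : (q zeroVec ^^ q a₁ ^^ q a₂ ^^ q (bxor a₁ a₂)) = false := by rw [hsymm]; exact h21
  have hb2 : (q zeroVec ^^ q b ^^ q a₂ ^^ q (bxor b a₂)) = true := by rw [hsymm]; exact h2b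
  -- symplectic Gram–Schmidt: correct `b` into the `B`-orthogonal complement of `⟨a₀, a₁⟩`
  cases hβ₁ : (q zeroVec ^^ q b ^^ q a₁ ^^ q (bxor b a₁)) <;> cases hβ₀ : (q zeroVec ^^ q b ^^ q a₀ ^^ q (bxor b a₀))
  · -- b already orthogonal
    refine ⟨a₀, a₁, a₂, b, h01, h2b, h02, ?_, h12, ?_⟩
    · rw [hsymm]; exact hβ₀
    · rw [hsymm]; exact hβ₁
  · -- B(b,a₀) = 1: correct by a₁
    refine ⟨a₀, a₁, a₂, bxor b a₁, h01, ?_, h02, ?_, h12, ?_⟩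
    · rw [hsymm, hadd, hb2, h12]; decide
    · rw [hsymm, hadd, hβ₀, h10]; decide
    · rw [hsymm, hadd, hβ₁, h11]; decide
  · -- B(b,a₁) = 1: correct by a₀
    refine ⟨a₀, a₁, a₂, bxor b a₀, h01, ?_, h02, ?_, h12, ?_⟩
    · rw [hsymm, hadd, hb2, h02]; decide
    · rw [hsymm, hadd, hβ₀, h00]; decide
    · rw [hsymm, hadd, hβ₁, h01]; decide
  · -- both: correct by a₀ and a₁
    refine ⟨a₀, a₁, a₂, bxor (bxor b a₀) a₁, h01, ?_, h02, ?_, h12, ?_⟩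
    · rw [hsymm, hadd, hadd, hb2, h02, h12]; decide
    · rw [hsymm, hadd, hadd, hβ₀, h00, h10]; decide
    · rw [hsymm, hadd, hadd, hβ₁, h01, h11]; decide

/-! ### The sign sum over the extracted 4-flat is `±4` -/

/-- The parity of a sum of four indicator bits is their xor. [folklore] -/
theorem es_decide_odd_four (p₀ p₁ p₂ p₃ : Bool) :
    decide (Odd ((if p₀ then 1 else 0) + (if p₁ then 1 else 0) + (if p₂ then 1 else 0) + (if p₃ then 1 else 0) : ℕ)) =
      (p₀ ^^ p₁ ^^ p₂ ^^ p₃) := by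
  cases p₀ <;> cases p₁ <;> cases p₂ <;> cases p₃ <;> decide

/-- Bridge between the two spellings of a parametrised 4-flat point: `b_j ⊕ [#{i : εᵢ ∧ a_{ij}} odd]` versus the explicit xor of
the four contributions. [folklore] -/
theorem es_flatPt_four (b : Fin n → Bool) (a : Fin 4 → Fin n → Bool) (ε : Fin 4 → Bool) :
    (fun j => b j ^^ decide (Odd #(univ.filter fun i => ε i && a i j))) =
      fun j => b j ^^ ((ε 0 && a 0 j) ^^ (ε 1 && a 1 j) ^^ (ε 2 && a 2 j) ^^ (ε 3 && a 3 j)) := by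
  funext j
  rw [card_filter, Fin.sum_univ_four, es_decide_odd_four]

/-- The explicit-xor flat point as an iterated `bxor`. [folklore] -/
theorem es_flatPt_bxor (b a₀ a₁ a₂ a₃ : Fin n → Bool) (ε : Fin 4 → Bool) :
    (fun j => b j ^^ ((ε 0 && a₀ j) ^^ (ε 1 && a₁ j) ^^ (ε 2 && a₂ j) ^^ (ε 3 && a₃ j))) =
      bxor (bxor (bxor (bxor b (fun j => ε 0 && a₀ j)) (fun j => ε 1 && a₁ j)) (fun j => ε 2 && a₂ j))
        (fun j => ε 3 && a₃ j) := by
  funext j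
  show _ = ((((b j ^^ (ε 0 && a₀ j)) ^^ (ε 1 && a₁ j)) ^^ (ε 2 && a₂ j)) ^^ (ε 3 && a₃ j))
  simp only [Bool.xor_assoc]

/-- `x ⊕ 0 = x` with the zero vector spelled as a lambda. [folklore] -/
theorem es_bxor_false (x : Fin n → Bool) : bxor x (fun _ => false) = x := bxor_zeroVec x

/-- **Taylor expansion on the extracted 4-flat.** With `B(a₀,a₁) = B(a₂,a₃) = 1` and the four cross values `0`:
`q(x₀ ⊕ Σ εᵢaᵢ) = q(x₀) ⊕ Σ εᵢ·(q(x₀) ⊕ q(x₀⊕aᵢ)) ⊕ ε₀ε₁ ⊕ ε₂ε₃`. [cite: Carlet2020, §5.2] -/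
theorem es_taylor_point (q : (Fin n → Bool) → Bool) (hq : IsDegLeFun 2 q) (a₀ a₁ a₂ a₃ : Fin n → Bool)
    (h01 : (q zeroVec ^^ q a₀ ^^ q a₁ ^^ q (bxor a₀ a₁)) = true) (h23 : (q zeroVec ^^ q a₂ ^^ q a₃ ^^ q (bxor a₂ a₃)) = true)
    (h02 : (q zeroVec ^^ q a₀ ^^ q a₂ ^^ q (bxor a₀ a₂)) = false) (h03 : (q zeroVec ^^ q a₀ ^^ q a₃ ^^ q (bxor a₀ a₃)) = false)
    (h12 : (q zeroVec ^^ q a₁ ^^ q a₂ ^^ q (bxor a₁ a₂)) = false) (h13 : (q zeroVec ^^ q a₁ ^^ q a₃ ^^ q (bxor a₁ a₃)) = false)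
    (x₀ : Fin n → Bool) (ε : Fin 4 → Bool) :
    q (fun j => x₀ j ^^ ((ε 0 && a₀ j) ^^ (ε 1 && a₁ j) ^^ (ε 2 && a₂ j) ^^ (ε 3 && a₃ j))) =
      (q x₀ ^^ (ε 0 && (q x₀ ^^ q (bxor x₀ a₀))) ^^ (ε 1 && (q x₀ ^^ q (bxor x₀ a₁))) ^^ (ε 0 && ε 1) ^^
        (ε 2 && (q x₀ ^^ q (bxor x₀ a₂))) ^^ (ε 3 && (q x₀ ^^ q (bxor x₀ a₃))) ^^ (ε 2 && ε 3)) := by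
  have hsd := es_second_deriv q hq
  rw [es_flatPt_bxor]
  cases h0 : ε 0 <;> cases h1 : ε 1 <;> cases h2 : ε 2 <;> cases h3 : ε 3 <;>
    simp only [es_bxor_false, hsd, h01, h23, h02, h03, h12, h13, Bool.true_and, Bool.false_and,
      Bool.xor_false, Bool.xor_true] <;>
    generalize q x₀ = A <;> generalize q (bxor x₀ a₀) = A0 <;> generalize q (bxor x₀ a₁) = A1 <;>
    generalize q (bxor x₀ a₂) = A2 <;> generalize q (bxor x₀ a₃) = A3 <;> revert A A0 A1 A2 A3 <;> decide

/-- The weight of `c ⊕ ε₀d₀ ⊕ ε₁d₁ ⊕ ε₀ε₁ ⊕ ε₂d₂ ⊕ ε₃d₃ ⊕ ε₂ε₃` on `𝔽₂⁴` is `6` or `10` (a bent quadratic on four bits plus an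
affine function). [cite: Carlet2020, §5.2] -/
theorem es_card_bentFour : ∀ (c d₀ d₁ d₂ d₃ : Bool),
    #(univ.filter fun ε : Fin 4 → Bool => (c ^^ (ε 0 && d₀) ^^ (ε 1 && d₁) ^^ (ε 0 && ε 1) ^^ (ε 2 && d₂) ^^ (ε 3 && d₃) ^^
      (ε 2 && ε 3)) = true) = 6 ∨
    #(univ.filter fun ε : Fin 4 → Bool => (c ^^ (ε 0 && d₀) ^^ (ε 1 && d₁) ^^ (ε 0 && ε 1) ^^ (ε 2 && d₂) ^^ (ε 3 && d₃) ^^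
      (ε 2 && ε 3)) = true) = 10 := by
  decide

/-- **The sign sum over the extracted 4-flat is `±4`.** [this work] -/
theorem es_flat_signsum (q : (Fin n → Bool) → Bool) (hq : IsDegLeFun 2 q) (a₀ a₁ a₂ a₃ : Fin n → Bool)
    (h01 : (q zeroVec ^^ q a₀ ^^ q a₁ ^^ q (bxor a₀ a₁)) = true) (h23 : (q zeroVec ^^ q a₂ ^^ q a₃ ^^ q (bxor a₂ a₃)) = true)
    (h02 : (q zeroVec ^^ q a₀ ^^ q a₂ ^^ q (bxor a₀ a₂)) = false) (h03 : (q zeroVec ^^ q a₀ ^^ q a₃ ^^ q (bxor a₀ a₃)) = false)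
    (h12 : (q zeroVec ^^ q a₁ ^^ q a₂ ^^ q (bxor a₁ a₂)) = false) (h13 : (q zeroVec ^^ q a₁ ^^ q a₃ ^^ q (bxor a₁ a₃)) = false)
    (x₀ : Fin n → Bool) :
    ∑ ε : Fin 4 → Bool, signOf (q (fun j => x₀ j ^^ decide (Odd #(univ.filter fun i => ε i && (![a₀, a₁, a₂, a₃] i) j)))) = 4 ∨
    ∑ ε : Fin 4 → Bool, signOf (q (fun j => x₀ j ^^ decide (Odd #(univ.filter fun i => ε i && (![a₀, a₁, a₂, a₃] i) j)))) = -4 := by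
  have hpt : ∀ ε : Fin 4 → Bool, q (fun j => x₀ j ^^ decide (Odd #(univ.filter fun i => ε i && (![a₀, a₁, a₂, a₃] i) j))) =
      (q x₀ ^^ (ε 0 && (q x₀ ^^ q (bxor x₀ a₀))) ^^ (ε 1 && (q x₀ ^^ q (bxor x₀ a₁))) ^^ (ε 0 && ε 1) ^^
        (ε 2 && (q x₀ ^^ q (bxor x₀ a₂))) ^^ (ε 3 && (q x₀ ^^ q (bxor x₀ a₃))) ^^ (ε 2 && ε 3)) := by
    intro ε
    rw [es_flatPt_four]
    simp only [Matrix.cons_val_zero, Matrix.cons_val_one]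
    rw [show (![a₀, a₁, a₂, a₃] : Fin 4 → Fin n → Bool) 2 = a₂ from rfl,
      show (![a₀, a₁, a₂, a₃] : Fin 4 → Fin n → Bool) 3 = a₃ from rfl]
    exact es_taylor_point q hq a₀ a₁ a₂ a₃ h01 h23 h02 h03 h12 h13 x₀ ε
  simp_rw [hpt]
  rw [fc_sum_signOf_eq_card]
  rcases es_card_bentFour (q x₀) (q x₀ ^^ q (bxor x₀ a₀)) (q x₀ ^^ q (bxor x₀ a₁)) (q x₀ ^^ q (bxor x₀ a₂))
    (q x₀ ^^ q (bxor x₀ a₃)) with h | h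
  · left; rw [h]; norm_num
  · right; rw [h]; norm_num

end Summit.QuantumAdvantage.QuantumAdvantage.Theorems.CubicForrelation.NearExactIsExact

end
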